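import Summits.RiemannHypothesis.RiemannHypothesis.Theorems.WeilGroundStateMarkovPartPositiveGroundStateLsc
import Summits.RiemannHypothesis.RiemannHypothesis.Theorems.WeilWindowFlowWindowLipschitzStubLocalizedCutAux
import Literature.Analysis.FunctionSpaces.MollificationLp

/-!
# Markov part of Weil's form: toolkit for the form-core density (mollifiers, shifts)

Support file for item `MarkovPartPositiveGroundState` of route `WeilGroundState`. Elementary `L²`
facts about the increments `D_t(f) = ∫ |f(x + t) − f(x)|² dx` used to prove that window test
functions are dense (from above) in the finite-energy class of the window:

* `weilIncrement_add_le`: `D_t(f + g) ≤ 2D_t(f) + 2D_t(g)`;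
* `weilIncrement_shift`: `D_t(f(· − δ)) = D_t(f)` (translation invariance of the jump form);
* `exists_mollified_seq`: mollifications `Kₙ ⋆ f` of `f ∈ L²` vanishing off `[-b, b]` are test
  functions on `[-(b + 1/(n+1)), b + 1/(n+1)]` with `D_t(Kₙ ⋆ f) ≤ D_t(f)` and `Kₙ ⋆ f → f` in `L²`
  (Young's inequality with `‖Kₙ‖₁ = 1`, tree file `MollificationLp`; a public copy of the private
  lemma of `WeilWindowFlowWindowLipschitzStubFormDomainPos`);
* `tendsto_weilIncrement_nhds_zero`: **continuity of translations in `L²`** for compactly supported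
  `f ∈ L²`: `D_s(f) → 0` as `s → 0` (approximate by the mollified test functions, whose increments
  are continuous, `continuous_weilIncrement`).

## References

* R. A. Adams, J. J. F. Fournier, *Sobolev Spaces* (2003), Thm 2.29 (mollifiers).
* M. Fukushima, Y. Oshima, M. Takeda, *Dirichlet Forms and Symmetric Markov Processes* (2011),
  Example 1.4.1 (`C_c^∞` is a core of translation-invariant jump forms).
-/

-- `Summit.RiemannHypothesis.RiemannHypothesis.…` repeats the summit name by design (D-0017 layout).
set_option linter.dupNamespace false

noncomputable section

open MeasureTheory Set Filter ContinuousLinearMap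
open scoped Topology ENNReal NNReal Convolution

namespace Summit.RiemannHypothesis.RiemannHypothesis.Theorems.WeilGroundStateMarkovPart

open Literature.NumberTheory.LFunctions Literature.NumberTheory.LFunctions.ConnesVanSuijlekom
open Summit.RiemannHypothesis.RiemannHypothesis.Theorems.WeilWindowFlowWindowLipschitz

/-! ## Increments of sums and shifts -/

/-- `D_t(f + g) ≤ 2 D_t(f) + 2 D_t(g)` for `f, g ∈ L²`. -/
theorem weilIncrement_add_le {f g : ℝ → ℂ} (hf : MemLp f 2) (hg : MemLp g 2) (t : ℝ) :
    weilIncrement (fun x ↦ f x + g x) t ≤ 2 * weilIncrement f t + 2 * weilIncrement g t := by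
  have hif := integrable_weilIncrement_integrand hf t
  have hig := integrable_weilIncrement_integrand hg t
  unfold weilIncrement
  rw [← integral_const_mul, ← integral_const_mul, ← integral_add (hif.const_mul 2) (hig.const_mul 2)]
  refine integral_mono_of_nonneg (Eventually.of_forall fun x ↦ by positivity)
    ((hif.const_mul 2).add (hig.const_mul 2)) (Eventually.of_forall fun x ↦ ?_)
  have e : f (x + t) + g (x + t) - (f x + g x) = (f (x + t) - f x) + (g (x + t) - g x) := by ring
  simp only [e]
  have h := norm_add_le (f (x + t) - f x) (g (x + t) - g x)
  nlinarith [h, norm_nonneg (f (x + t) - f x + (g (x + t) - g x)), norm_nonneg (f (x + t) - f x),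
    norm_nonneg (g (x + t) - g x), sq_nonneg (‖f (x + t) - f x‖ - ‖g (x + t) - g x‖)]

/-- **Translation invariance**: `D_t(f(· − δ)) = D_t(f)`. -/
theorem weilIncrement_shift (f : ℝ → ℂ) (δ t : ℝ) :
    weilIncrement (fun x ↦ f (x - δ)) t = weilIncrement f t := by
  unfold weilIncrement
  have h := integral_sub_right_eq_self (μ := (volume : Measure ℝ))
    (fun x ↦ ‖f (x + t) - f x‖ ^ 2) δ
  rw [← h]
  refine integral_congr_ae (Eventually.of_forall fun x ↦ ?_)
  simp only
  rw [show x + t - δ = x - δ + t by ring]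

/-- A shift of an `L²` function is in `L²`. -/
theorem memLp_shift {f : ℝ → ℂ} (hf : MemLp f 2) (δ : ℝ) : MemLp (fun x ↦ f (x - δ)) 2 :=
  hf.comp_measurePreserving (measurePreserving_sub_right volume δ)

/-- `∫ |f(x − δ) − f(x)|² dx = D_{−δ}(f)`. -/
theorem integral_norm_sq_shift_sub (f : ℝ → ℂ) (δ : ℝ) :
    ∫ x, ‖f (x - δ) - f x‖ ^ 2 = weilIncrement f (-δ) := by
  unfold weilIncrement
  simp only [sub_eq_add_neg]

/-! ## Mollification into a slightly larger window -/

/-- **Mollification contracts increments.** For the normalised bump kernel `K = φ.normed` and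
`f ∈ L²`, `D_t(K ⋆ f) ≤ D_t(f)` for every `t` (the increment of `K ⋆ f` is `K ⋆ (f(· + t) − f)`,
and Young's inequality with `‖K‖₁ = 1` contracts `L²` norms). -/
theorem weilIncrement_mollify_le (φ : ContDiffBump (0 : ℝ)) {f : ℝ → ℂ} (hf : MemLp f 2)
    (t : ℝ) :
    weilIncrement (φ.normed volume ⋆[lsmul ℝ ℝ, volume] f) t ≤ weilIncrement f t := by
  set K : ℝ → ℝ := φ.normed volume
  set h : ℝ → ℂ := fun y ↦ f (y + t) - f y with hh
  have hfl : LocallyIntegrable f volume := hf.locallyIntegrable one_le_two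
  have hhm : MemLp h 2 volume :=
    (hf.comp_measurePreserving (measurePreserving_add_right volume t)).sub hf
  have hpt : ∀ x, (K ⋆[lsmul ℝ ℝ, volume] f) (x + t) - (K ⋆[lsmul ℝ ℝ, volume] f) x =
      (K ⋆[lsmul ℝ ℝ, volume] h) x := by
    intro x
    have e1 := ((φ.hasCompactSupport_normed (μ := volume)).convolutionExists_left (lsmul ℝ ℝ)
      φ.continuous_normed hfl (x + t)).integrable
    have e2 := ((φ.hasCompactSupport_normed (μ := volume)).convolutionExists_left (lsmul ℝ ℝ)
      φ.continuous_normed hfl x).integrable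
    simp only [lsmul_apply] at e1 e2
    simp only [convolution_lsmul]
    rw [← integral_sub e1 e2]
    refine integral_congr_ae (Eventually.of_forall fun s ↦ ?_)
    simp only [hh, smul_sub]
    congr 3
    ring
  have hKh : MemLp (K ⋆[lsmul ℝ ℝ, volume] h) 2 volume :=
    Literature.Analysis.UnboundedOperators.memLp_convolution_lsmul φ.integrable_normed hhm
      one_le_two
  have hY := Literature.Analysis.FunctionSpaces.eLpNorm_normed_convolution_le_haar (μ := volume)
    φ hhm.1 one_le_two
  rw [eLpNorm_two_eq_ofReal_sqrt hKh, eLpNorm_two_eq_ofReal_sqrt hhm,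
    ENNReal.ofReal_le_ofReal_iff (Real.sqrt_nonneg _),
    Real.sqrt_le_sqrt_iff (integral_nonneg fun _ ↦ by positivity)] at hY
  have hlhs : weilIncrement (K ⋆[lsmul ℝ ℝ, volume] f) t =
      ∫ x, ‖(K ⋆[lsmul ℝ ℝ, volume] h) x‖ ^ 2 := by
    unfold weilIncrement
    simp_rw [hpt]
  rw [hlhs, weilIncrement]
  exact hY

/-- **Mollified approximants of a compactly supported `L²` function.** For `f ∈ L²` vanishing off
`[-b, b]` the mollifications `gₙ = Kₙ ⋆ f` by normalised bumps of outer radius `1/(n+1)` are test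
functions supported in `[-(b + 1/(n+1)), b + 1/(n+1)]`, have increments `D_t(gₙ) ≤ D_t(f)` for
every `t`, and converge to `f` in `L²`. -/
theorem exists_mollified_seq {b : ℝ} {f : ℝ → ℂ} (hf : MemLp f 2)
    (hfs : ∀ x, x ∉ Icc (-b) b → f x = 0) :
    ∃ g : ℕ → ℝ → ℂ,
      (∀ n, IsWeilTest (g n)) ∧
      (∀ n, tsupport (g n) ⊆ Icc (-(b + 1 / ((n : ℝ) + 1))) (b + 1 / ((n : ℝ) + 1))) ∧
      (∀ n t, weilIncrement (g n) t ≤ weilIncrement f t) ∧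
      Tendsto (fun n ↦ ∫ x, ‖g n x - f x‖ ^ 2) atTop (𝓝 0) := by
  set φ : ℕ → ContDiffBump (0 : ℝ) := fun n ↦
    ⟨1 / ((n : ℝ) + 2), 1 / ((n : ℝ) + 1), by positivity,
      one_div_lt_one_div_of_lt (by positivity) (by linarith)⟩
  have hrOut : ∀ n, (φ n).rOut = 1 / ((n : ℝ) + 1) := fun n ↦ rfl
  have hfl : LocallyIntegrable f volume := hf.locallyIntegrable one_le_two
  have hfc : HasCompactSupport f := HasCompactSupport.intro isCompact_Icc hfs
  have hmem : ∀ n, MemLp ((φ n).normed volume ⋆[lsmul ℝ ℝ, volume] f) 2 volume := fun n ↦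
    Literature.Analysis.UnboundedOperators.memLp_convolution_lsmul (φ n).integrable_normed hf
      one_le_two
  refine ⟨fun n ↦ (φ n).normed volume ⋆[lsmul ℝ ℝ, volume] f, fun n ↦ ⟨?_, ?_⟩, fun n ↦ ?_,
    fun n t ↦ weilIncrement_mollify_le (φ n) hf t, ?_⟩
  · exact ((φ n).hasCompactSupport_normed (μ := volume)).contDiff_convolution_left _
      (φ n).contDiff_normed hfl
  · exact ((φ n).hasCompactSupport_normed (μ := volume)).convolution _ hfc
  · refine closure_minimal (fun x hx ↦ ?_) isClosed_Icc
    obtain ⟨y, hy, z, hz, rfl⟩ := support_convolution_subset (L := lsmul ℝ ℝ) (μ := volume)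
      (f := (φ n).normed volume) (g := f) hx
    rw [(φ n).support_normed_eq, hrOut, Metric.mem_ball, dist_zero_right, Real.norm_eq_abs,
      abs_lt] at hy
    have hz' : z ∈ Icc (-b) b := not_not.1 fun h ↦ hz (hfs z h)
    constructor <;> linarith [hz'.1, hz'.2, hy.1, hy.2]
  · have hT := Literature.Analysis.FunctionSpaces.tendsto_eLpNorm_normed_convolution_sub_self
      (μ := volume) (φ := φ) (l := atTop)
      (tendsto_one_div_add_atTop_nhds_zero_nat (𝕜 := ℝ)) one_le_two ENNReal.ofNat_ne_top hf
    have hT' : Tendsto (fun n ↦ Real.sqrt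
        (∫ x, ‖((φ n).normed volume ⋆[lsmul ℝ ℝ, volume] f) x - f x‖ ^ 2)) atTop (𝓝 0) := by
      have h2 := (ENNReal.tendsto_toReal ENNReal.zero_ne_top).comp hT
      rw [ENNReal.toReal_zero] at h2
      refine h2.congr fun n ↦ ?_
      rw [Function.comp_apply, eLpNorm_two_eq_ofReal_sqrt ((hmem n).sub hf),
        ENNReal.toReal_ofReal (Real.sqrt_nonneg _)]
      rfl
    have h3 := hT'.pow 2
    rw [zero_pow two_ne_zero] at h3
    refine h3.congr fun n ↦ ?_
    exact Real.sq_sqrt (integral_nonneg fun _ ↦ by positivity)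

/-! ## Continuity of translations in `L²` -/

/-- `D_t(f) ≤ 2 D_t(g) + 8 ∫|f − g|²` for `f, g ∈ L²` (the increment map is `2`-Lipschitz). -/
theorem weilIncrement_le_of_near {f g : ℝ → ℂ} (hf : MemLp f 2) (hg : MemLp g 2) (t : ℝ) :
    weilIncrement f t ≤ 2 * weilIncrement g t + 8 * ∫ x, ‖f x - g x‖ ^ 2 := by
  have h1 := weilIncrement_add_le hg (hf.sub hg) t
  have e : (fun x ↦ g x + (f - g) x) = f := by funext x; simp
  rw [e] at h1
  have h2 : weilIncrement (f - g) t ≤ 4 * ∫ x, ‖f x - g x‖ ^ 2 := by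
    have := integral_norm_sq_increment_sub_le hf hg t
    unfold weilIncrement
    refine le_of_eq_of_le (integral_congr_ae (Eventually.of_forall fun x ↦ ?_)) this
    simp only [Pi.sub_apply]
    ring_nf
  linarith

/-- **Continuity of translations in `L²` (compact support)**: for `f ∈ L²` vanishing off `[-b, b]`,
`D_s(f) = ∫ |f(x+s) − f(x)|² dx → 0` as `s → 0` (approximate `f` in `L²` by the mollified test
functions `gₙ`, whose increments are continuous in `s` with `D_0(gₙ) = 0`, and use
`D_s(f) ≤ 2D_s(gₙ) + 8‖f − gₙ‖₂²`). -/
theorem tendsto_weilIncrement_nhds_zero {b : ℝ} {f : ℝ → ℂ} (hf : MemLp f 2)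
    (hfs : ∀ x, x ∉ Icc (-b) b → f x = 0) :
    Tendsto (weilIncrement f) (𝓝 0) (𝓝 0) := by
  obtain ⟨g, hg, -, -, hlim⟩ := exists_mollified_seq hf hfs
  rw [Metric.tendsto_nhds]
  intro ε hε
  have hε8 : (0 : ℝ) < ε / 16 := by positivity
  obtain ⟨N, hN⟩ := (Metric.tendsto_nhds.1 hlim) (ε / 16) hε8 |>.exists_forall_of_atTop
  have hN' : ∫ x, ‖g N x - f x‖ ^ 2 < ε / 16 := by
    have := hN N le_rfl
    rw [Real.dist_eq, sub_zero, abs_of_nonneg (integral_nonneg fun _ ↦ by positivity)] at this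
    exact this
  have hcont : Tendsto (weilIncrement (g N)) (𝓝 0) (𝓝 0) := by
    have h := (continuous_weilIncrement (hg N)).tendsto 0
    have h0 : weilIncrement (g N) 0 = 0 := by simp [weilIncrement]
    rwa [h0] at h
  have hev := (Metric.tendsto_nhds.1 hcont) (ε / 4) (by positivity)
  filter_upwards [hev] with s hs
  rw [Real.dist_eq, sub_zero, abs_of_nonneg (weilIncrement_nonneg _ _)] at hs ⊢
  have h1 := weilIncrement_le_of_near hf (hg N).memLp_two s
  have h2 : ∫ x, ‖f x - g N x‖ ^ 2 = ∫ x, ‖g N x - f x‖ ^ 2 :=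
    integral_congr_ae (Eventually.of_forall fun x ↦ by simp only [norm_sub_rev])
  rw [h2] at h1
  linarith

end Summit.RiemannHypothesis.RiemannHypothesis.Theorems.WeilGroundStateMarkovPart

end
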